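import Mathlib.Analysis.Complex.MeanValue
import Mathlib.MeasureTheory.Integral.CircleAverage
import Mathlib.MeasureTheory.Group.LIntegral
import Literature.Analysis.Complex.LengthArea
import Literature.Analysis.FluidPDE.PoincareBall
import HarnessLib

/-!
# The sub-mean-value inequality on discs and the `L²` oscillation bound for holomorphic maps

Topic `Literature/Analysis/Complex`. Everything here is PROVED.

For `g` holomorphic on the disc `B(z, r)`, the mean value property on circles
(`DiffContOnCl.circleAverage`, Mathlib) and the Cauchy–Schwarz inequality (the tree's
`PoincareBall.sq_lintegral_le_measure_mul_lintegral_sq`) give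
`2π ‖g z‖² ≤ ∫_{-π}^{π} ‖g(z + ρ e^{iθ})‖² dθ` for `0 < ρ < r`, and integrating `ρ dρ` (polar
coordinates) the **sub-mean-value inequality** `π r² ‖g z‖² ≤ ∫∫_{B(z,r)} ‖g‖²`. Applied to
`g = F'` and combined with the mean value inequality on a segment, it bounds the oscillation of a
holomorphic `F` between two nearby points by the Dirichlet integral on a slightly larger disc:
`π ρ² ‖F y - F x‖² ≤ |y - x|² ∫∫_{B(x,R)} ‖F'‖²` whenever `|y - x| + ρ ≤ R`. This is the
conformal (`L²`-gradient) form of the "adjacent Whitney cubes" estimate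
`|f(Q) - f(Q')| ≤ C (|∇f|(Q) l(Q) + |∇f|(Q') l(Q'))` of Jones–Smirnov (Ark. Mat. 38 (2000),
p. 271), used in the chain argument of their Proposition 1
(`Literature/Probability/RandomPlanarGeometry/ConformalRemovability*.lean`).

* `two_pi_mul_enorm_sq_le_lintegral_circle` — the circle estimate (`E`-valued).
* `pi_mul_sq_mul_enorm_sq_le_lintegral_ball` — the disc estimate for measurable `g : ℂ → ℂ`;
  `pi_mul_sq_mul_enorm_deriv_sq_le_lintegral_ball` — the case `g = deriv F`.
* `pi_mul_sq_mul_enorm_sub_sq_le` — the oscillation bound for `F` holomorphic on `B(x, R)`.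

All statements are in `ℝ≥0∞` (Lebesgue integrals of `‖·‖ₑ ^ 2`), so that no integrability
hypothesis is needed. The square (Cartesian) analogue is the tree's
`Literature.Analysis.Complex.norm_sq_le_integral_norm_sq_square`.

## References

* E. C. Titchmarsh, *The Theory of Functions*, 2nd ed. (1939), §2.5 (mean value property);
  the area form is [folklore] (Bergman-space point evaluation).
* [JonesSmirnov2000] P. W. Jones, S. K. Smirnov, Ark. Mat. 38 (2000) 263–279, p. 271.
-/

noncomputable section

open Set Filter Metric MeasureTheory Complex Real
open scoped Topology ENNReal NNReal

namespace Literature.Analysis.Complex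

/-! ### The circle estimate -/

section Circle

variable {E : Type*} [NormedAddCommGroup E] [NormedSpace ℂ E] [CompleteSpace E]

/-- **Sub-mean-value inequality on circles.** For `g` holomorphic on `B(z, r)` and `0 < ρ < r`:
`2π ‖g z‖² ≤ ∫_{-π}^{π} ‖g (z + ρ e^{iθ})‖² dθ` (mean value property `g z = ⨍ g(z + ρe^{iθ}) dθ`
and Cauchy–Schwarz). [folklore] -/
theorem two_pi_mul_enorm_sq_le_lintegral_circle {g : ℂ → E} {z : ℂ} {r ρ : ℝ}
    (hg : DifferentiableOn ℂ g (ball z r)) (hρ : 0 < ρ) (hρr : ρ < r) :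
    ENNReal.ofReal (2 * π) * ‖g z‖ₑ ^ 2 ≤ ∫⁻ θ in Ioo (-π) π, ‖g (circleMap z ρ θ)‖ₑ ^ 2 := by
  -- the mean value property on the circle of radius `ρ`, over the angle range `(-π, π]`
  have hdc : DiffContOnCl ℂ g (ball z |ρ|) := by
    refine DifferentiableOn.diffContOnCl (hg.mono ?_)
    rw [abs_of_pos hρ, closure_ball z hρ.ne']
    exact closedBall_subset_ball hρr
  have hmv : circleAverage g z ρ = g z := hdc.circleAverage
  rw [circleAverage_eq_integral_add (-π),
    intervalIntegral.integral_comp_add_right (fun θ ↦ g (circleMap z ρ θ)), zero_add,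
    show 2 * π + -π = π by ring] at hmv
  -- notation
  set μ : Measure ℝ := volume.restrict (Ioo (-π) π) with hμ
  set h : ℝ → ℝ≥0∞ := fun θ ↦ ‖g (circleMap z ρ θ)‖ₑ with hh
  have hmem : ∀ θ, circleMap z ρ θ ∈ ball z r := fun θ ↦ by
    rw [mem_ball, mem_sphere.1 (circleMap_mem_sphere z hρ.le θ)]
    exact hρr
  have hcont : Continuous fun θ ↦ g (circleMap z ρ θ) :=
    hg.continuousOn.comp_continuous (continuous_circleMap z ρ) hmem
  have hmeas : AEMeasurable h μ := hcont.enorm.measurable.aemeasurable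
  have hπ : -π ≤ π := by linarith [pi_pos]
  -- `2π ‖g z‖ ≤ ∫ ‖g ∘ circleMap‖`
  have h1 : ENNReal.ofReal (2 * π) * ‖g z‖ₑ ≤ ∫⁻ θ, h θ ∂μ := by
    rw [← hmv, enorm_smul, intervalIntegral.integral_of_le hπ, ← mul_assoc]
    have hc : ENNReal.ofReal (2 * π) * ‖(2 * π)⁻¹‖ₑ = 1 := by
      rw [Real.enorm_eq_ofReal (by positivity), ← ENNReal.ofReal_mul (by positivity),
        mul_inv_cancel₀ (by positivity), ENNReal.ofReal_one]
    rw [hc, one_mul, hμ, restrict_Ioo_eq_restrict_Ioc]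
    exact enorm_integral_le_lintegral_enorm _
  -- Cauchy–Schwarz on `(-π, π)`
  have h2 : (∫⁻ θ, h θ ∂μ) ^ 2 ≤ ENNReal.ofReal (2 * π) * ∫⁻ θ, h θ ^ 2 ∂μ := by
    have := Literature.Analysis.FluidPDE.PoincareBall.sq_lintegral_le_measure_mul_lintegral_sq
      μ hmeas
    rwa [show μ univ = ENNReal.ofReal (2 * π) by
      rw [hμ, Measure.restrict_apply_univ, Real.volume_Ioo]; ring_nf] at this
  have h3 : (ENNReal.ofReal (2 * π) * ‖g z‖ₑ) ^ 2 ≤ ENNReal.ofReal (2 * π) * ∫⁻ θ, h θ ^ 2 ∂μ :=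
    (pow_le_pow_left' h1 2).trans h2
  rw [mul_pow, pow_two (ENNReal.ofReal (2 * π)), mul_assoc] at h3
  have h0 : ENNReal.ofReal (2 * π) ≠ 0 := (ENNReal.ofReal_pos.2 (by positivity)).ne'
  have htop : ENNReal.ofReal (2 * π) ≠ ∞ := ENNReal.ofReal_ne_top
  exact (ENNReal.mul_le_mul_iff_right h0 htop).1 h3

end Circle

/-! ### The disc estimate -/

/-- `∫_{(0,r)} ρ dρ = r² / 2` as a Lebesgue integral. [folklore] -/
theorem lintegral_Ioo_ofReal_self {r : ℝ} (hr : 0 ≤ r) :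
    ∫⁻ ρ in Ioo (0 : ℝ) r, ENNReal.ofReal ρ = ENNReal.ofReal (r ^ 2 / 2) := by
  rw [← ofReal_integral_eq_lintegral_ofReal]
  · rw [← integral_Ioc_eq_integral_Ioo, ← intervalIntegral.integral_of_le hr, integral_id]
    ring_nf
  · exact (continuous_id.integrableOn_Icc (a := 0) (b := r)).mono_set Ioo_subset_Icc_self
  · exact ae_restrict_of_forall_mem measurableSet_Ioo fun x hx ↦ hx.1.le

/-- **Sub-mean-value inequality on discs.** For a measurable `g : ℂ → ℂ` holomorphic on the
disc `B(z, r)`, `r > 0`: `π r² ‖g z‖² ≤ ∫∫_{B(z,r)} ‖g‖²` (the circle estimate integrated in polar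
coordinates about `z`). [folklore] -/
theorem pi_mul_sq_mul_enorm_sq_le_lintegral_ball {g : ℂ → ℂ} {z : ℂ} {r : ℝ} (hr : 0 < r)
    (hg : DifferentiableOn ℂ g (ball z r)) (hgm : Measurable g) :
    ENNReal.ofReal (π * r ^ 2) * ‖g z‖ₑ ^ 2 ≤ ∫⁻ w in ball z r, ‖g w‖ₑ ^ 2 := by
  set G : ℂ → ℝ≥0∞ := fun w ↦ ‖g w‖ₑ ^ 2 with hG
  have hGm : Measurable G := hgm.enorm.pow_const 2
  have hIm : Measurable ((ball z r).indicator G) := hGm.indicator measurableSet_ball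
  -- polar coordinates about `z`
  have hpolar : ∫⁻ w in ball z r, G w = ∫⁻ ρ in Ioi (0 : ℝ), ∫⁻ θ in Ioo (-π) π,
      ENNReal.ofReal ρ * (ball z r).indicator G (circleMap z ρ θ) := by
    rw [← lintegral_indicator measurableSet_ball,
      ← lintegral_add_left_eq_self ((ball z r).indicator G) z,
      ← Complex.lintegral_comp_polarCoord_symm]
    simp only [LengthArea.polarCoord_symm_eq, smul_eq_mul]
    rw [LengthArea.lintegral_polarCoord_target_eq]
    · rfl
    · exact measurable_fst.ennreal_ofReal.mul (hIm.comp (by fun_prop))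
  rw [hpolar]
  have hc : ENNReal.ofReal (2 * π) * ‖g z‖ₑ ^ 2 ≠ ∞ :=
    ENNReal.mul_ne_top ENNReal.ofReal_ne_top (ENNReal.pow_ne_top enorm_ne_top)
  calc ENNReal.ofReal (π * r ^ 2) * ‖g z‖ₑ ^ 2
      = ∫⁻ ρ in Ioo (0 : ℝ) r, ENNReal.ofReal ρ * (ENNReal.ofReal (2 * π) * ‖g z‖ₑ ^ 2) := by
        rw [lintegral_mul_const' _ _ hc, lintegral_Ioo_ofReal_self hr.le,
          ← mul_assoc, ← ENNReal.ofReal_mul (by positivity)]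
        congr 2
        ring
    _ ≤ ∫⁻ ρ in Ioo (0 : ℝ) r, ENNReal.ofReal ρ * ∫⁻ θ in Ioo (-π) π, G (circleMap z ρ θ) := by
        refine setLIntegral_mono' measurableSet_Ioo fun ρ hρ ↦ ?_
        gcongr
        exact two_pi_mul_enorm_sq_le_lintegral_circle hg hρ.1 hρ.2
    _ = ∫⁻ ρ in Ioo (0 : ℝ) r, ∫⁻ θ in Ioo (-π) π,
          ENNReal.ofReal ρ * (ball z r).indicator G (circleMap z ρ θ) := by
        refine setLIntegral_congr_fun measurableSet_Ioo fun ρ hρ ↦ ?_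
        rw [← lintegral_const_mul' _ _ ENNReal.ofReal_ne_top]
        refine lintegral_congr fun θ ↦ ?_
        rw [indicator_of_mem]
        rw [mem_ball, mem_sphere.1 (circleMap_mem_sphere z hρ.1.le θ)]
        exact hρ.2
    _ ≤ ∫⁻ ρ in Ioi (0 : ℝ), ∫⁻ θ in Ioo (-π) π,
          ENNReal.ofReal ρ * (ball z r).indicator G (circleMap z ρ θ) :=
        lintegral_mono_set Ioo_subset_Ioi_self

/-- **Sub-mean-value inequality for the derivative**: for `F` holomorphic on `B(z, r)`, `r > 0`,
`π r² ‖F' z‖² ≤ ∫∫_{B(z,r)} ‖F'‖²`. [folklore] -/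
theorem pi_mul_sq_mul_enorm_deriv_sq_le_lintegral_ball {F : ℂ → ℂ} {z : ℂ} {r : ℝ} (hr : 0 < r)
    (hF : DifferentiableOn ℂ F (ball z r)) :
    ENNReal.ofReal (π * r ^ 2) * ‖deriv F z‖ₑ ^ 2 ≤ ∫⁻ w in ball z r, ‖deriv F w‖ₑ ^ 2 :=
  pi_mul_sq_mul_enorm_sq_le_lintegral_ball hr
    ((hF.analyticOnNhd isOpen_ball).deriv.differentiableOn) (measurable_deriv F)

/-! ### The oscillation bound -/

/-- **`L²` oscillation bound for holomorphic maps** (conformal form of Jones–Smirnov's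
adjacent-cubes estimate, Ark. Mat. 38 (2000) p. 271). Let `F` be holomorphic on `B(x, R)`,
`ρ > 0` and `|y - x| + ρ ≤ R`. Then `π ρ² ‖F y - F x‖² ≤ |y - x|² ∫∫_{B(x,R)} ‖F'‖²`: every point
`w` of the segment `[x, y]` has `B(w, ρ) ⊆ B(x, R)`, so `π ρ² ‖F' w‖²` is at most the Dirichlet
integral, and the mean value inequality applies. [folklore] -/
theorem pi_mul_sq_mul_enorm_sub_sq_le {F : ℂ → ℂ} {x y : ℂ} {R ρ : ℝ} (hρ : 0 < ρ)
    (hyR : dist y x + ρ ≤ R) (hF : DifferentiableOn ℂ F (ball x R)) :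
    ENNReal.ofReal (π * ρ ^ 2) * ‖F y - F x‖ₑ ^ 2 ≤
      ENNReal.ofReal (dist y x ^ 2) * ∫⁻ w in ball x R, ‖deriv F w‖ₑ ^ 2 := by
  set A : ℝ≥0∞ := ∫⁻ w in ball x R, ‖deriv F w‖ₑ ^ 2 with hA
  rcases eq_or_ne A ∞ with hA' | hA'
  · by_cases hd : dist y x = 0
    · rw [dist_eq_zero.1 hd]
      simp
    · rw [hA', ENNReal.mul_top ((ENNReal.ofReal_pos.2 (by positivity)).ne')]
      exact le_top
  -- pointwise bound for `‖F'‖` on the closed disc `|w - x| ≤ |y - x|`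
  set C : ℝ := Real.sqrt (A.toReal / (π * ρ ^ 2)) with hC
  have hbound : ∀ w ∈ closedBall x (dist y x), ‖deriv F w‖ ≤ C := by
    intro w hw
    rw [mem_closedBall] at hw
    have hwball : ball w ρ ⊆ ball x R := by
      intro v hv
      rw [mem_ball] at hv ⊢
      calc dist v x ≤ dist v w + dist w x := dist_triangle _ _ _
        _ < ρ + dist y x := by linarith
        _ ≤ R := by linarith
    have h3 : ENNReal.ofReal (π * ρ ^ 2) * ‖deriv F w‖ₑ ^ 2 ≤ A :=
      (pi_mul_sq_mul_enorm_deriv_sq_le_lintegral_ball hρ (hF.mono hwball)).trans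
        (lintegral_mono_set hwball)
    have h4 : π * ρ ^ 2 * ‖deriv F w‖ ^ 2 ≤ A.toReal := by
      have := ENNReal.toReal_mono hA' h3
      rwa [ENNReal.toReal_mul, ENNReal.toReal_ofReal (by positivity), ← ofReal_norm,
        ← ENNReal.ofReal_pow (norm_nonneg _), ENNReal.toReal_ofReal (by positivity)] at this
    have h5 : ‖deriv F w‖ ^ 2 ≤ A.toReal / (π * ρ ^ 2) := by
      rw [le_div_iff₀ (by positivity)]
      linarith
    calc ‖deriv F w‖ = Real.sqrt (‖deriv F w‖ ^ 2) := (Real.sqrt_sq (norm_nonneg _)).symm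
      _ ≤ C := Real.sqrt_le_sqrt h5
  -- mean value inequality on the convex closed disc
  have hsub : closedBall x (dist y x) ⊆ ball x R := closedBall_subset_ball (by linarith)
  have hmv : ‖F y - F x‖ ≤ C * dist y x := by
    have := (convex_closedBall x (dist y x)).norm_image_sub_le_of_norm_deriv_le
      (fun w hw ↦ hF.differentiableAt (isOpen_ball.mem_nhds (hsub hw))) hbound
      (mem_closedBall_self dist_nonneg) (mem_closedBall.2 le_rfl)
    rwa [← dist_eq_norm y x] at this
  have hC0 : 0 ≤ C := Real.sqrt_nonneg _
  have hreal : π * ρ ^ 2 * ‖F y - F x‖ ^ 2 ≤ dist y x ^ 2 * A.toReal := by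
    have h1 : ‖F y - F x‖ ^ 2 ≤ C ^ 2 * dist y x ^ 2 := by
      rw [← mul_pow]
      exact pow_le_pow_left₀ (norm_nonneg _) hmv 2
    have h2 : C ^ 2 = A.toReal / (π * ρ ^ 2) := Real.sq_sqrt (by positivity)
    rw [h2] at h1
    have h3 : π * ρ ^ 2 * ‖F y - F x‖ ^ 2 ≤ π * ρ ^ 2 * (A.toReal / (π * ρ ^ 2) * dist y x ^ 2) :=
      mul_le_mul_of_nonneg_left h1 (by positivity)
    calc π * ρ ^ 2 * ‖F y - F x‖ ^ 2 ≤ π * ρ ^ 2 * (A.toReal / (π * ρ ^ 2) * dist y x ^ 2) := h3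
      _ = dist y x ^ 2 * A.toReal := by field_simp
  calc ENNReal.ofReal (π * ρ ^ 2) * ‖F y - F x‖ₑ ^ 2
      = ENNReal.ofReal (π * ρ ^ 2 * ‖F y - F x‖ ^ 2) := by
        rw [← ofReal_norm, ← ENNReal.ofReal_pow (norm_nonneg _),
          ← ENNReal.ofReal_mul (by positivity)]
    _ ≤ ENNReal.ofReal (dist y x ^ 2 * A.toReal) := ENNReal.ofReal_le_ofReal hreal
    _ = ENNReal.ofReal (dist y x ^ 2) * A := by
        rw [ENNReal.ofReal_mul (by positivity), ENNReal.ofReal_toReal hA']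

end Literature.Analysis.Complex
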